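import Mathlib
import Summits.Ventures.PercRepro.TriangleCapThreeRowDiagonalLocus
import Summits.Ventures.PercRepro.TriangleCapDiamondExtremal
import Summits.Ventures.PercRepro.TriangleCapSecondBestParity

/-!
# PercRepro — THE THIRD ORDER ON THE DIAGONAL CELL `(10, 3, 0)`: a `K₄⁻`-free graph with `21` edges on `10`
vertices is `3`-bipartite (then `K_{3,7}`), or `4`-bipartite (then at least `18` below `m k`), or at least `20`
below `m k` — the third family `K_{5,5}` minus a `4`-star is sharp (p3, gen 46; part 199a)

The stability table of §10bt(e) at second order (parts 194–198) says: on the diagonal `(k, 3, 0)` a non-`3`-bipartite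
graph is at least `B2 = 6 (k − 7)` below `m k`, sharp by the `4`-bipartite family `K_{4,k−4}` minus a `(k − 7)`-star.
THE THIRD ORDER asks what lies below the `4`-bipartite graphs: on `(10, 21)` the census (kit j316691) says the graphs
that are neither `3`- nor `4`-bipartite have minimum gap `20 = B3 = (2k − 16)(15 − k)` with `6,300` maximisers, all of
them `K_{5,5}` minus a `4`-star. This module proves the bound. The vertex types: a vertex at the cap `7` makes `D`
`3`-bipartite (`three_row_cap`); every degree in `[4, 6]` gives `k (k − 7) = 30` by the convexity of the row `4`
(`diag_convex`); a vertex `z` of degree `≤ 3` is deleted: `d = 0` is impossible (`4 · 21 > 81`,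
`four_mul_card_edges_le_sq`); `d = 1`: `D − z` is `K_{4,5}` exactly (`k4mFree_extremal_complete`), the neighbour on the
`4`-side makes `D` `4`-bipartite, on the `5`-side it has degree `4` and the count closes at `190` exactly (the third
family); `d = 2`: `D − z` lies on the cell `(9, 4, 1)` at `≤ 164` (`one_below_second_order_gen` / the bipartite closed
form) and the two neighbours at `≤ 5` close the count at `190` exactly; `d = 3`: `D − z` lies on `(9, 3, 0)`: `K_{3,6}`
(then the three neighbours of `z` lie on one side, `D` is `3`- or `4`-bipartite), or `≤ 148` (then `T ≤ 15` closes the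
count), or exactly `150`, the second-order locus at `k = 9` (`three_diag_second_locus_nine`): the `B2` family (the
neighbours of `z` in its `4`-side make `D` `4`-bipartite, a neighbour off it has degree `≤ 4`) or the hung `K_{4,4}`
(at most two vertices of degree `5`, `hungK44_card_deg_five`) — in both `T ≤ 14` and the count closes at `190`.
`three_diag_third_best_ten`: the third-best value of `Σ_v d(v)²` on `(10, 21)` — over the graphs that are neither
`3`- nor `4`-bipartite — is at most `190 = m k − 20`. Axioms: standard.
-/

namespace PercRepro

namespace TriangleCap

namespace C047

open Finset

variable {V : Type*} [Fintype V] [DecidableEq V]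

/-- A sum of values `≤ 5` over `N` is at most `4 |N|` plus the number of values equal to `5`. -/
theorem sum_le_four_mul_card_add_filter {W : Type*} (N : Finset W) (f : W → ℕ) (hf : ∀ w ∈ N, f w ≤ 5) :
    ∑ w ∈ N, f w ≤ 4 * N.card + (N.filter (fun w => f w = 5)).card := by
  calc ∑ w ∈ N, f w ≤ ∑ w ∈ N, (4 + if f w = 5 then 1 else 0) := by
        apply sum_le_sum
        intro w hw
        have := hf w hw
        split_ifs <;> omega
    _ = 4 * N.card + (N.filter (fun w => f w = 5)).card := by
        rw [sum_add_distrib, sum_const, smul_eq_mul, card_filter, mul_comm]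

/-- The deleted-neighbour sum as a sum over the neighbours of `z` in `D − z`. -/
theorem sum_del_nbhd_eq_sum_filter (D : SimpleGraph V) [DecidableRel D.Adj] (z : V) :
    ∑ a : {v : V // v ≠ z}, (if D.Adj a.1 z then deg (del D z) a else 0) =
      ∑ a ∈ univ.filter (fun a : {v : V // v ≠ z} => D.Adj a.1 z), deg (del D z) a := by
  rw [sum_filter]

/-- The neighbours of `z` have degree `≤ c` in `D − z` when every degree of `D` is `≤ c + 1`. -/
theorem deg_del_le_of_adj (D : SimpleGraph V) [DecidableRel D.Adj] (z : V) (c : ℕ)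
    (hcap : ∀ v, deg D v ≤ c + 1) (a : {v : V // v ≠ z}) (ha : D.Adj a.1 z) : deg (del D z) a ≤ c := by
  have h := deg_del D z a
  rw [if_pos ha] at h
  have := hcap a.1
  omega

/-- **THE THIRD ORDER ON `(10, 21)`:** `K₄⁻`-free, `k = 10`, `m = 21` ⇒ `D` is a spanning subgraph of some `K(A, Aᶜ)`
with `|A| = 3`, or of one with `|A| = 4`, or `Σ_v d(v)² + 20 ≤ m k`. -/
theorem three_diag_third_order_ten (D : SimpleGraph V) [DecidableRel D.Adj] (hK : K4mFree D)
    (hk : Fintype.card V = 10) (hm : D.edgeFinset.card = 21) :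
    (∃ A : Finset V, A.card = 3 ∧ BipSub D A) ∨ (∃ A : Finset V, A.card = 4 ∧ BipSub D A) ∨
      ∑ v, deg D v * deg D v + 20 ≤ D.edgeFinset.card * Fintype.card V := by
  -- (A) a vertex at the cap `7` makes `D` `3`-bipartite
  by_cases hx : ∃ x, deg D x + 3 = Fintype.card V
  · obtain ⟨x, hx⟩ := hx
    rcases three_row_cap D hK 0 (by omega) (by omega) x hx with h | ⟨h1, -⟩
    · exact Or.inl h
    · omega
  push Not at hx
  have hcap : ∀ v, deg D v + 3 ≤ Fintype.card V := fun v =>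
    deg_add_le_card_of_dense D hK 3 (by norm_num) (by omega)
      (cap_arith 3 (Fintype.card V) D.edgeFinset.card 0 (by norm_num) (by omega) (by omega)) v
  have hcap' : ∀ v, deg D v + 4 ≤ Fintype.card V := fun v => by
    have h1 := hcap v
    have h2 := hx v
    omega
  have hcap6 : ∀ v, deg D v ≤ 5 + 1 := fun v => by have := hcap' v; omega
  -- (B) every degree `≥ 4`: the convexity of the row `4` gives `30`
  by_cases hdeg : ∀ v, 4 ≤ deg D v
  · right; right
    have h := diag_convex D (by omega) (by omega) hcap' hdeg
    rw [hk, hm] at h ⊢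
    omega
  push Not at hdeg
  obtain ⟨z, hz⟩ := hdeg
  -- the deletion bookkeeping
  have hK' := k4mFree_del D hK z
  have hcard' := card_del z
  have hedges' := card_edges_del D z
  have hsq := sum_deg_sq_del D z
  have hT := sum_del_nbhd_le D z 5 hcap6
  have hTfilt := sum_del_nbhd_eq_sum_filter D z
  have hNz := card_nbhd_del D z
  obtain ⟨T, hTdef⟩ : ∃ T, ∑ a : {v : V // v ≠ z}, (if D.Adj a.1 z then deg (del D z) a else 0) = T := ⟨_, rfl⟩
  obtain ⟨S', hS'def⟩ : ∃ S', ∑ a : {v : V // v ≠ z}, deg (del D z) a * deg (del D z) a = S' := ⟨_, rfl⟩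
  obtain ⟨m', hm'def⟩ : ∃ m', (del D z).edgeFinset.card = m' := ⟨_, rfl⟩
  obtain ⟨Nz, hNzdef⟩ : ∃ Nz : Finset {v : V // v ≠ z}, Nz = univ.filter (fun a : {v : V // v ≠ z} => D.Adj a.1 z) :=
    ⟨_, rfl⟩
  have hmemNz : ∀ a : {v : V // v ≠ z}, a ∈ Nz ↔ D.Adj a.1 z := fun a => by
    rw [hNzdef, mem_filter]
    simp only [mem_univ, true_and]
  rw [hTdef, hS'def] at hsq
  rw [hTdef] at hT hTfilt
  rw [← hNzdef] at hTfilt hNz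
  rw [hm'def] at hedges'
  have hcardW' : Fintype.card {v : V // v ≠ z} = 9 := by omega
  have hdegNz : ∀ a ∈ Nz, deg (del D z) a ≤ 5 := fun a ha =>
    deg_del_le_of_adj D z 5 hcap6 a ((hmemNz a).mp ha)
  -- `T ≤ 12 + #{neighbours of degree 5}`
  have hT14 : T ≤ 4 * Nz.card + (Nz.filter (fun a => deg (del D z) a = 5)).card := by
    rw [hTfilt]
    exact sum_le_four_mul_card_add_filter Nz (fun a => deg (del D z) a) hdegNz
  have hd : deg D z = 0 ∨ deg D z = 1 ∨ deg D z = 2 ∨ deg D z = 3 := by omega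
  rcases hd with hd0 | hd1 | hd2 | hd3
  · -- `d = 0`: `21` edges on `9` vertices, impossible
    exfalso
    have h := four_mul_card_edges_le_sq (del D z) hK' (by omega)
    rw [hm'def, hcardW'] at h
    omega
  · -- `d = 1`: `D − z` is `K_{4,5}`
    have hm'20 : m' = 20 := by omega
    obtain ⟨A', hA'card, hiff⟩ := k4mFree_extremal_complete (del D z) hK' (by omega)
      (by rw [hm'def, hcardW', hm'20])
    rw [hcardW'] at hA'card
    have hB : BipSub (del D z) A' := fun x y h => ((hiff x y).mp h).1
    -- the neighbour `w`
    rw [hd1] at hNz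
    obtain ⟨w, hw⟩ := card_eq_one.mp hNz
    have hwz : D.Adj w.1 z := (hmemNz w).mp (by rw [hw]; exact mem_singleton_self w)
    by_cases hwA : w ∈ A'
    · -- on the `4`-side: `D` is `4`-bipartite
      obtain ⟨B, hBcard, hBsub⟩ := bipSub_lift D z A' hB (fun a ha => by
        have : a ∈ Nz := (hmemNz a).mpr ha
        rw [hw, mem_singleton] at this
        rw [this]
        exact hwA)
      exact Or.inr (Or.inl ⟨B, by rw [hBcard, hA'card], hBsub⟩)
    · -- on the `5`-side: degree `≤ 4`, the count closes at `190`
      right; right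
      have hdw : deg (del D z) w ≤ 4 := by
        have := deg_le_card_of_bipSub (del D z) A' hB w hwA
        rw [hA'card] at this
        exact this
      have hT4 : T ≤ 4 := by
        rw [hTfilt, hw, sum_singleton]
        exact hdw
      have henv := sum_deg_sq_le_of_k4mFree (del D z) hK' (by omega)
      rw [hS'def, hm'def, hcardW', hm'20] at henv
      rw [hsq, hk, hm, hd1]
      omega
  · -- `d = 2`: `D − z` lies on the cell `(9, 4, 1)` at `≤ 164`
    right; right
    have hm'19 : m' = 19 := by omega
    have hS164 : S' ≤ 164 := by
      rcases one_below_second_order_gen (del D z) hK' 4 (le_refl 4) (by omega)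
        (by rw [hm'def, hcardW', hm'19]) with ⟨A', hA'card, hB⟩ | h
      · have := sum_deg_sq_le_of_bipSub (del D z) A' hB 4 1 hA'card (by rw [hm'def, hcardW', hm'19])
          (by omega)
        rw [hS'def, hm'def, hcardW', hm'19] at this
        omega
      · rw [hS'def, hm'def, hcardW', hm'19] at h
        omega
    rw [hd2] at hT
    rw [hsq, hk, hm, hd2]
    omega
  · -- `d = 3`: `D − z` lies on the diagonal `(9, 3, 0)`
    have hm'18 : m' = 18 := by omega
    rw [hd3] at hT hNz
    rcases diag_second_order (del D z) hK' (by omega) (by rw [hm'def, hcardW', hm'18])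
      with ⟨A', hA'card, hA'⟩ | hgap
    · -- `D − z` is `K_{3,6}`: the three neighbours of `z` lie on one side
      have hfull : ∀ {x y : {v : V // v ≠ z}}, x ∈ A' → y ∉ A' → (del D z).Adj x y := fun hx hy =>
        adj_of_bipSub_full (del D z) A' hA' 3 hA'card (by rw [hm'def, hcardW', hm'18]) hx hy
      by_cases hall : ∀ a : {v : V // v ≠ z}, D.Adj a.1 z → a ∈ A'
      · obtain ⟨B, hBcard, hB⟩ := bipSub_lift D z A' hA' hall
        exact Or.inl ⟨B, by rw [hBcard, hA'card], hB⟩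
      · push Not at hall
        obtain ⟨a₀, ha₀z, ha₀A⟩ := hall
        -- every neighbour of `z` is off `A'`
        have hoff : ∀ a : {v : V // v ≠ z}, D.Adj a.1 z → a ∉ A' := by
          intro a₁ ha₁z ha₁A
          have hne01 : a₀ ≠ a₁ := fun h => ha₀A (h ▸ ha₁A)
          obtain ⟨a₂, ha₂z, ha₂0, ha₂1⟩ : ∃ a₂ : {v : V // v ≠ z}, D.Adj a₂.1 z ∧ a₂ ≠ a₀ ∧ a₂ ≠ a₁ := by
            have h2 : 2 < Nz.card := by omega
            obtain ⟨b₁, hb₁, b₂, hb₂, b₃, hb₃, h12, h13, h23⟩ := two_lt_card.mp h2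
            rw [hmemNz] at hb₁ hb₂ hb₃
            by_cases e1 : b₁ = a₀ ∨ b₁ = a₁
            · by_cases e2 : b₂ = a₀ ∨ b₂ = a₁
              · refine ⟨b₃, hb₃, ?_, ?_⟩
                · intro h; rcases e1 with rfl | rfl <;> rcases e2 with rfl | rfl <;>
                    first | exact h12 rfl | exact h13 h | exact h13 h.symm | exact h23 h | exact h23 h.symm
                · intro h; rcases e1 with rfl | rfl <;> rcases e2 with rfl | rfl <;>
                    first | exact h12 rfl | exact h13 h | exact h13 h.symm | exact h23 h | exact h23 h.symm
              · push Not at e2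
                exact ⟨b₂, hb₂, e2.1, e2.2⟩
            · push Not at e1
              exact ⟨b₁, hb₁, e1.1, e1.2⟩
          have h10 : D.Adj a₁.1 a₀.1 := (del_adj D z a₁ a₀).mp (hfull ha₁A ha₀A)
          by_cases ha₂A : a₂ ∈ A'
          · have h20 : D.Adj a₂.1 a₀.1 := (del_adj D z a₂ a₀).mp (hfull ha₂A ha₀A)
            exact not_adj_both D hK (D.adj_symm ha₀z) (D.adj_symm ha₁z) (D.adj_symm h10)
              (fun h => ha₂1 (Subtype.ext h).symm) (D.adj_symm ha₂z) (D.adj_symm h20)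
          · have h12' : D.Adj a₁.1 a₂.1 := (del_adj D z a₁ a₂).mp (hfull ha₁A ha₂A)
            exact not_adj_both D hK (D.adj_symm ha₁z) (D.adj_symm ha₀z) h10
              (fun h => ha₂0 (Subtype.ext h).symm) (D.adj_symm ha₂z) h12'
        obtain ⟨B, hBcard, hB⟩ := bipSub_insert_of_nbhd_off D z A' hA' hoff
        exact Or.inr (Or.inl ⟨B, by rw [hBcard, hA'card], hB⟩)
    · -- `D − z` is not `3`-bipartite: `S' ≤ 150`
      rw [hS'def, hm'def, hcardW', hm'18] at hgap
      have hnb : ¬ ∃ A' : Finset {v : V // v ≠ z}, A'.card = 3 ∧ BipSub (del D z) A' := by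
        rintro ⟨A', hA'card, hA'⟩
        have hne' : Nonempty {v : V // v ≠ z} := Fintype.card_pos_iff.mp (by omega)
        obtain ⟨v⟩ := hne'
        have hstar : MissingStar (del D z) A' v := fun x y hx hy hxy =>
          absurd (adj_of_bipSub_full (del D z) A' hA' 3 hA'card (by rw [hm'def, hcardW', hm'18]) hx hy) hxy
        have h := closed_form_eq_of_missingStar (del D z) A' hA' hstar 3 0 hA'card
          (by rw [hm'def, hcardW', hm'18]) (by omega)
        rw [hS'def, hm'def, hcardW', hm'18] at h
        simp only [zero_mul, add_zero] at h
        omega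
      by_cases hS148 : S' + 2 ≤ 150
      · -- `S' ≤ 148`: `T ≤ 15` closes the count
        right; right
        rw [hsq, hk, hm, hd3]
        omega
      · -- `S' = 150`: the second-order locus at `k = 9`
        have hS150 : S' = 150 := by
          obtain ⟨t, ht⟩ := even_sum_deg_sq (del D z)
          rw [hS'def] at ht
          omega
        have hS'eq : ∑ a : {v : V // v ≠ z}, deg (del D z) a * deg (del D z) a = 150 := by rw [hS'def, hS150]
        rcases three_diag_second_locus_nine (del D z) hK' hcardW' (by rw [hm'def, hm'18]) hnb hS'eq
          with ⟨A', v, hA'card, hB, -⟩ | hH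
        · -- the `B2` family: the neighbours of `z` in `A'` make `D` `4`-bipartite
          by_cases hall : ∀ a : {v : V // v ≠ z}, D.Adj a.1 z → a ∈ A'
          · obtain ⟨B, hBcard, hBsub⟩ := bipSub_lift D z A' hB hall
            exact Or.inr (Or.inl ⟨B, by rw [hBcard, hA'card], hBsub⟩)
          · right; right
            push Not at hall
            obtain ⟨w₀, hw₀z, hw₀A⟩ := hall
            have hdw₀ : deg (del D z) w₀ ≤ 4 := by
              have := deg_le_card_of_bipSub (del D z) A' hB w₀ hw₀A
              rw [hA'card] at this
              exact this
            have hfilt : (Nz.filter (fun a => deg (del D z) a = 5)).card ≤ 2 := by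
              have hsub : Nz.filter (fun a => deg (del D z) a = 5) ⊆ Nz.erase w₀ := by
                intro a ha
                rw [mem_filter] at ha
                rw [mem_erase]
                refine ⟨?_, ha.1⟩
                intro h
                rw [h] at ha
                omega
              have := card_le_card hsub
              rw [card_erase_of_mem ((hmemNz w₀).mpr hw₀z), hNz] at this
              omega
            rw [hsq, hk, hm, hd3]
            rw [hNz] at hT14
            omega
        · -- the hung `K_{4,4}`: at most two vertices of degree `5`
          right; right
          have hfilt := hungK44_card_deg_five (del D z) hcardW' hH (Nz.filter (fun a => deg (del D z) a = 5))
            (fun a ha => (mem_filter.mp ha).2)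
          rw [hsq, hk, hm, hd3]
          rw [hNz] at hT14
          omega

/-- **THE THIRD-BEST VALUE ON `(10, 21)`:** every `K₄⁻`-free graph on `Fin 10` with `21` edges that is neither
`3`- nor `4`-bipartite has `Σ_v d(v)² ≤ 190 = m k − 20`. -/
theorem three_diag_third_best_ten (D : SimpleGraph (Fin 10)) [DecidableRel D.Adj] (hK : K4mFree D)
    (hm : D.edgeFinset.card = 21) (h3 : ¬ ∃ A : Finset (Fin 10), A.card = 3 ∧ BipSub D A)
    (h4 : ¬ ∃ A : Finset (Fin 10), A.card = 4 ∧ BipSub D A) :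
    ∑ v, deg D v * deg D v ≤ 190 := by
  have hk : Fintype.card (Fin 10) = 10 := Fintype.card_fin 10
  rcases three_diag_third_order_ten D hK hk hm with h | h | h
  · exact absurd h h3
  · exact absurd h h4
  · rw [hk, hm] at h
    omega

end C047

end TriangleCap

end PercRepro
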